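import Summits.CriticalPhenomena.SAWScalingLimit.Theses.SAWReversalUpgrade
import HarnessLib

/-!
# Crux idea `excursion-yardstick-root` (round 2, ideator 5) for `SAWReversalUpgrade.NoDeepReturn`
# (stmt-CriticalPhenomena-18004): typed pieces and the composition claim

Lever: an exact domain-Markov cut at the FIRST VERTEX OF THE WALK IN THE OUTER LATTICE COMPONENT of
`b_δ` (vertices of `Ω_δ` joined to `b_δ` by a lattice path staying strictly outside the closed ball
`B̄(a, ρ)`), followed by a Hölder-weak SAW-versus-random-walk-bridge domination (`RootYardstick`, the
ONE open atom, the root instance of route SAWBrownianDomination's `UniformDomination` restricted to a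
class that excludes the recorded two-corridor flip), and — on the random-walk side only — discrete
Beurling / maximum-principle estimates (`RootBeurling`, `ExcursionBoundaryProximity`), Jordan fill
geometry (`FillGeometry`) and the law-level Markov glue (`MarkovAtOuterEntry`), all provable.

Nothing here is registered; `sorry` appears only in the composition claim `crux_of_yardstick`
(crux-plan would turn the five hypotheses into stubs). Every `def` elaborates over tree declarations.
-/

noncomputable section

namespace Summit.CriticalPhenomena.SAWScalingLimit.Cruxes.NoDeepReturn.Yardstick

open MeasureTheory Filter Topology Set Metric
open scoped NNReal ENNReal
open Literature.Probability.RandomPlanarGeometry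
open Literature.Probability.RandomPlanarGeometry.SAW
open Literature.Probability.LatticeModels (Site meshPoint discreteDomainGraph meshDomain)

/-- The crux, by name. -/
abbrev Crux : Prop := Summit.CriticalPhenomena.SAWScalingLimit.Theses.SAWReversalUpgrade.NoDeepReturn

/-! ## §1 The cut: the outer lattice component of `w` outside the closed ball `B̄(c, ρ)` -/

/-- **Outer lattice component.** The vertices of `Ω_δ` joined to `w` by a walk of `Ω_δ` all of whose
vertices lie at distance `> ρ` from `c` (so `w` itself must be outside the closed ball). For
`c = a = D.pt 0`, `w = b_δ` this is "b's component of `Ω_δ ∖ B̄(a,ρ)`" at the LATTICE level: lobes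
of `D ∖ B̄(a,ρ)` not containing `b`, and continuum-open but lattice-closed necks, are excluded by
construction, so from any of its vertices `b_δ` is reachable WITHOUT re-entering the ball. -/
def outerComp (Ω : Set ℂ) (δ : ℝ) (c : ℂ) (ρ : ℝ) (w : Site 2) : Set (Site 2) :=
  {v | ∃ p : (discreteDomainGraph Ω δ).Walk v w, ∀ u ∈ p.support, ρ < dist (meshPoint δ u) c}

/-- **Admissible cut** of a SAW of `(Ω_δ; a₀ → b₀)` at the outer component: the past `η` (a walk
from the root vertex `a₀` to `y`) has NO vertex in the outer component, and `z ∼ y` is the first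
vertex that does (the tip of the past is `y`; the future starts at `z`). -/
def AdmissibleCut (Ω : Set ℂ) (δ : ℝ) (c : ℂ) (ρ : ℝ) (a₀ b₀ y z : Site 2)
    (η : (discreteDomainGraph Ω δ).Walk a₀ y) : Prop :=
  (discreteDomainGraph Ω δ).Adj y z ∧ z ∈ outerComp Ω δ c ρ b₀ ∧
    ∀ u ∈ η.support, u ∉ outerComp Ω δ c ρ b₀

/-! ## §2 The random-walk yardstick (shape verbatim from `SAWBrownianDomination.UniformDomination`) -/

/-- `Σ 4^{-|ω|}` over nearest-neighbour walks `z → w` of `Ω_δ` avoiding `F` (the discrete bridge /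
Green-normalised path measure, un-normalised). -/
def rwTotal (Ω : Set ℂ) (δ : ℝ) (F : Set (Site 2)) (z w : Site 2) : ℝ≥0∞ :=
  ∑' ω : (discreteDomainGraph Ω δ).Walk z w,
    Set.indicator {ω' | ∀ x ∈ ω'.support, x ∉ F} (fun ω' => (4 : ℝ≥0∞)⁻¹ ^ ω'.length) ω

/-- Same sum restricted to walks hitting `S`. -/
def rwHit (Ω : Set ℂ) (δ : ℝ) (F S : Set (Site 2)) (z w : Site 2) : ℝ≥0∞ :=
  ∑' ω : (discreteDomainGraph Ω δ).Walk z w,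
    Set.indicator {ω' | (∀ x ∈ ω'.support, x ∉ F) ∧ ∃ x ∈ ω'.support, x ∈ S}
      (fun ω' => (4 : ℝ≥0∞)⁻¹ ^ ω'.length) ω

/-- The `s`-boundary layer of the root annulus `ρ/2 ≤ |· − a| ≤ 2ρ` (lattice sites). -/
def annularLayer (D : DobrushinDomain) (δ ρ s : ℝ) : Set (Site 2) :=
  {v | infDist (meshPoint δ v) D.carrierᶜ < s ∧ ρ / 2 ≤ dist (meshPoint δ v) (D.pt 0) ∧
    dist (meshPoint δ v) (D.pt 0) ≤ 2 * ρ}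

/-! ## §3 THE OPEN ATOM -/

/-- **ROOT YARDSTICK** (the one open atom of the line; Hölder-weak Brownian-excursion domination
AT THE ROOT, per-domain eventual constants). Two instances.
(i) NIL PAST, ANNULAR BOUNDARY LAYERS: the critical SAW of `(Ω_δ; a_δ, b_δ)` visits the `s`-boundary
layer of a root annulus no more than `C ·(the 4^{-|ω|}-bridge from a_δ to b_δ does)^θ`.
(ii) CUT PASTS: for every admissible cut `(η, z)` at the outer component of `b_δ` outside `B̄(a,ρ)`
whose tip `z` is `s`-inside `D`, and every target `S` inside the closed cut ball,
`P_SAW[future hits S | future avoids η] ≤ C · (P_RW-bridge in Ω_δ∖η [hits S])^θ`, cross-multiplied in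
`ℝ≥0∞` exactly as in `UniformDomination` (stmt-CriticalPhenomena-11295). The class is chosen so that the
S-avoiding alternative of both walks is the η-FREE, δ-INDEPENDENT outer region (no competing
lattice-thin corridors: the two-corridor flip that misstates 11295 does not embed), and so that the
random-walk side is SMALL by Beurling (`RootBeurling`). Continuum form (θ = 1): LSW03,
`1 − Φ'_A(0)^{5/8} ≤ 1 − Φ'_A(0)`. -/
def RootYardstick : Prop :=
  (∀ (D : DobrushinDomain) (a b : ℝ → Site 2), IsEndpointApprox D a b → ∀ ρ : ℝ, 0 < ρ →
    ∃ (C : ℝ≥0) (θ : ℝ), 0 < θ ∧ ∀ᶠ δ in 𝓝[>] (0 : ℝ), ∀ s : ℝ, 0 < s →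
      law D.carrier δ (a δ) (b δ) {γ | ∃ x ∈ γ.walk.support, x ∈ annularLayer D δ ρ s} *
          (rwTotal D.carrier δ ∅ (a δ) (b δ)) ^ θ ≤
        (C : ℝ≥0∞) * (rwHit D.carrier δ ∅ (annularLayer D δ ρ s) (a δ) (b δ)) ^ θ) ∧
  (∀ (D : DobrushinDomain) (a b : ℝ → Site 2), IsEndpointApprox D a b → ∀ ρ : ℝ, 0 < ρ →
    ∀ s : ℝ, 0 < s → ∃ (C : ℝ≥0) (θ : ℝ), 0 < θ ∧ ∀ᶠ δ in 𝓝[>] (0 : ℝ),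
      ∀ (S : Set (Site 2)), S ⊆ {v | dist (meshPoint δ v) (D.pt 0) ≤ ρ} →
      ∀ (y z : Site 2) (η : (discreteDomainGraph D.carrier δ).Walk (a δ) y),
        AdmissibleCut D.carrier δ (D.pt 0) ρ (a δ) (b δ) y z η →
        s ≤ infDist (meshPoint δ z) D.carrierᶜ →
        law D.carrier δ z (b δ)
            {γ | (∀ x ∈ γ.walk.support, x ∉ η.support) ∧ ∃ x ∈ γ.walk.support, x ∈ S} *
            (rwTotal D.carrier δ {u | u ∈ η.support} z (b δ)) ^ θ ≤
          (C : ℝ≥0∞) * law D.carrier δ z (b δ) {γ | ∀ x ∈ γ.walk.support, x ∉ η.support} *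
            (rwHit D.carrier δ {u | u ∈ η.support} S z (b δ)) ^ θ)

/-! ## §4 The provable pieces (random-walk potential theory, Jordan geometry, Markov glue) -/

/-- **ROOT BEURLING** (random-walk side; discrete potential theory in the FIXED domain, uniform
over cut pasts because the past lives inside the contaminated region and the target is a ball at a
BOUNDARY point `a ∈ ∂D`: reaching `B̄(a,r)` from distance `ρ` avoiding the connected killing set `Dᶜ`
costs `≲ (r/ρ)^{1/2}` (Kesten's discrete Beurling estimate, Lawler–Limic §6.8) whatever else kills;
the return leg is compared with the δ-independent outer route by the maximum principle and Harnack
in the η-free outer region `s/2`-inside `D`; constants depend on `(D, ρ, s)`). -/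
def RootBeurling : Prop :=
  ∀ (D : DobrushinDomain) (a b : ℝ → Site 2), IsEndpointApprox D a b → ∀ ρ : ℝ, 0 < ρ →
    ∀ s : ℝ, 0 < s → ∀ η₀ : ℝ, 0 < η₀ → ∃ r : ℝ, 0 < r ∧ ∀ᶠ δ in 𝓝[>] (0 : ℝ),
      ∀ (y z : Site 2) (η : (discreteDomainGraph D.carrier δ).Walk (a δ) y),
        AdmissibleCut D.carrier δ (D.pt 0) ρ (a δ) (b δ) y z η →
        s ≤ infDist (meshPoint δ z) D.carrierᶜ →
        rwHit D.carrier δ {u | u ∈ η.support} {v | dist (meshPoint δ v) (D.pt 0) ≤ r} z (b δ) ≤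
          ENNReal.ofReal η₀ * rwTotal D.carrier δ {u | u ∈ η.support} z (b δ)

/-- **EXCURSION BOUNDARY PROXIMITY** (random-walk side, fixed domain, nil past): the `4^{-|ω|}`
bridge of `Ω_δ` from `a_δ` to `b_δ` visits the `s`-boundary layer of the root annulus at radius `ρ`
with probability `→ 0` as `s → 0`, eventually in `δ` (Brownian excursions do not touch `∂D` away
from their endpoints; invariance principle for the h-transformed walk in the fixed Jordan domain,
or a direct discrete estimate). -/
def ExcursionBoundaryProximity : Prop :=
  ∀ (D : DobrushinDomain) (a b : ℝ → Site 2), IsEndpointApprox D a b → ∀ ρ : ℝ, 0 < ρ →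
    2 * ρ < dist (D.pt 0) (D.pt 1) →
    ∀ η₀ : ℝ, 0 < η₀ → ∃ s : ℝ, 0 < s ∧ ∀ᶠ δ in 𝓝[>] (0 : ℝ),
      rwHit D.carrier δ ∅ (annularLayer D δ ρ s) (a δ) (b δ) ≤
        ENNReal.ofReal η₀ * rwTotal D.carrier δ ∅ (a δ) (b δ)

/-- **FILL GEOMETRY** (topology of Jordan domains + mesh graphs, provable; two-point form): for
`ρ` small (given `ε, s`) and all small `δ`, any two vertices of ONE component of `Ω_δ` that are both
`ε`-far from `a` and `s`-inside `D` are joined by a walk of `Ω_δ` staying strictly outside `B̄(a,ρ)`.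
(Proof idea: the `s/2`-interior of `D` is compact and any two of its points are joined in `D` with a
uniform clearance `c(D,s) > 0`; for `δ < c/2` these are lattice paths inside the `c/2`-interior, which
is disjoint from `B̄(a,ρ)` once `ρ < c/2` because `a ∈ ∂D`.) Used with `v` = the SAW's first `ε`-far
vertex and `w` = an `s`-inside vertex of the SAW's final passage through a mid-annulus (after its
last exit from `B̄(a,ρ)`), which is joined to `b_δ` outside the ball by the SAW itself. -/
def FillGeometry : Prop :=
  ∀ (D : DobrushinDomain), ∀ ε : ℝ, 0 < ε → ∀ s : ℝ, 0 < s → ∃ ρ : ℝ, 0 < ρ ∧ ρ < ε ∧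
    ∀ᶠ δ in 𝓝[>] (0 : ℝ), ∀ v w : Site 2, (discreteDomainGraph D.carrier δ).Reachable v w →
      ε ≤ dist (meshPoint δ v) (D.pt 0) → s ≤ infDist (meshPoint δ v) D.carrierᶜ →
      ε ≤ dist (meshPoint δ w) (D.pt 0) → s ≤ infDist (meshPoint δ w) D.carrierᶜ →
      ∃ p : (discreteDomainGraph D.carrier δ).Walk v w, ∀ u ∈ p.support, ρ < dist (meshPoint δ u) (D.pt 0)

/-- **MARKOV AT OUTER ENTRY** (exact domain Markov of the `x_c`-law, summed over admissible cuts;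
provable, the law-level cousin of the landed `stub_firstEntranceFarBound` p159214 and of the census'
`FirstEntryReduction`): if for every admissible cut with a `G`-tip the conditional probability that
the future hits `E` is `≤ η₀`, then the probability that the FIRST outer-component vertex is a
`G`-vertex and a LATER vertex lies in `E` is `≤ η₀`. (Cylinders of distinct cut pasts are disjoint;
the weight factorises `x_c^{|past|} · x_c · x_c^{|future|}` with the future a SAW of `Ω_δ` from `z`
avoiding the past's vertices.) -/
def MarkovAtOuterEntry : Prop :=
  ∀ (Ω : Set ℂ), Bornology.IsBounded Ω → ∀ (δ : ℝ), 0 < δ →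
    ∀ (c : ℂ) (ρ : ℝ) (u w : Site 2) (G E : Set (Site 2)) (η₀ : ℝ≥0∞),
      u ∉ outerComp Ω δ c ρ w →
      (∀ (y z : Site 2) (η : (discreteDomainGraph Ω δ).Walk u y),
          AdmissibleCut Ω δ c ρ u w y z η → z ∈ G →
          law Ω δ z w {γ | (∀ x ∈ γ.walk.support, x ∉ η.support) ∧ ∃ x ∈ γ.walk.support, x ∈ E} ≤
            η₀ * law Ω δ z w {γ | ∀ x ∈ γ.walk.support, x ∉ η.support}) →
      law Ω δ u w {γ | ∃ i j : ℕ, i ≤ j ∧ j ≤ γ.walk.length ∧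
          (∀ k : ℕ, k < i → γ.walk.getVert k ∉ outerComp Ω δ c ρ w) ∧
          γ.walk.getVert i ∈ outerComp Ω δ c ρ w ∧ γ.walk.getVert i ∈ G ∧
          γ.walk.getVert j ∈ E} ≤ η₀

/-! ## §5 The composition claim (proof = crux-plan; sketch in the card) -/

/-- **Composition (the line, to be built in crux-plan).** Given `ε, η₀` (shrink `ε` below `|a−b|/8`):
`ExcursionBoundaryProximity` + `RootYardstick`(i) at radius `ε` and at the mid radius `|a−b|/4`
price the events "the first ε-far vertex is `s₁`-close to `∂D`" and "some vertex of the mid-annulus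
`[|a−b|/8, |a−b|/2]` is `s₁`-close to `∂D`"; off both, `FillGeometry (ε, s₁)` gives the cut radius
`ρ < ε` such that the first far vertex `v` and an `s₁`-inside vertex `w` of the walk's FINAL passage
through the mid-annulus (after its last exit from `B̄(a,ρ)`, hence joined to `b_δ` outside the ball by
the walk itself) are joined outside the ball — so `v ∈ outerComp(ρ)` and the first outer-component
index precedes the far index, hence the deep return; `ExcursionBoundaryProximity` at `ρ` +
`RootYardstick`(i) price "the cut tip `z` is `s₂`-close to `∂D`"; `RootBeurling (ρ, s₂)` gives `r` and
`RootYardstick`(ii) turns it into the SAW bound for good tips; `MarkovAtOuterEntry` (with `G` = good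
tips, `E` = the `r`-ball) sums over cuts; the landed polyline↔vertex conversion (p158730 /
`noDeepReturn_vertex` p159051) closes. Union of three small terms. -/
theorem crux_of_yardstick (hY : RootYardstick) (hB : RootBeurling)
    (hP : ExcursionBoundaryProximity) (hF : FillGeometry) (hM : MarkovAtOuterEntry) : Crux := by
  sorry

end Summit.CriticalPhenomena.SAWScalingLimit.Cruxes.NoDeepReturn.Yardstick

end
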